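import Literature.MathematicalPhysics.QuantumFieldTheory.Balaban1983to89.B14FlowStep

/-!
# `Balaban1983to89.B15Ineq194Flow` (v1) — B15 (1.94), first inequality, AS PRINTED and SIGN-FREE: the
`δ′`-instance of B14 (2.8) («Similar inequalities hold for other constants») by the D-sb14.1a mechanism

CITATION HEADER (lean-in-tree rule 2026-08-18).  Sources: (B15 = [IV]) T. Bałaban, *Large field renormalization. I.
The basic step of the 𝐑 operation*, Commun. Math. Phys. **122**, 175–202 (1989), bib `Balaban1989LargeFieldI` (held:
`paper:balaban1989-cmp122-large-field-i`; journal page = PDF page + 174); (B14 = [III]) T. Bałaban, *Convergent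
renormalization expansions for lattice gauge theories*, Commun. Math. Phys. **119**, 243–285 (1988), bib
`Balaban1988Convergent` (held: `paper:balaban1988-cmp119-convergent-renormalization`; journal page = PDF page + 242).
Both papers are manuscripts UNDER ADJUDICATION by the audit cell `pub-balaban`; nothing of them is asserted here as a
fact.  The quotations below were READ AS IMAGES on the x2 page renders of the cell
(`run/shared/lean/pub/pub-balaban/b2b-balaban-ref1/pages/1989-cmp122-large-field-I/…-p009-x2.png`, `…-p024-x2.png` =
[IV] pp. 183, 198; `…/1988-cmp119-convergent-renormalization/…-p013-x2.png` = [III] p. 255), not on an OCR layer: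

* [IV] p. 183 [9], l. 1: *"where δ′_j = g_j A₁ p₁(g_j), p₁(g_j) = (log g_j⁻²)^{p₁}, and p₁ < p₀; other conditions on
  p₁ will be formulated later."*
* [IV] p. 198 [24], (1.94) and the sentence after it: *"The function ℍ_{h,□} above, and its derivatives, can be bounded
  on □̃ by
  B₃δ′_k + L^{−(k−h)}O(1)B₃³B₅M⁶ε_k ≤ B₃(1 + β₀)N^{1/2} (A₁/A₀) (p₁(g_h)/p₀(g_h)) ε_h + L^{−N}N^{1/2}O(1)B₃³B₅M⁶ε_h < αε_h.
  (1.94)  The last inequality holds under two restrictions on N."* (here `N = k − h`, [IV] p. 177).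
* [III] p. 255 [13], (2.4): *"ε_j = g_j A₀(log g_j⁻²)^{p₀} = g_j p₀(g_j)"*; (2.6): *"g_n ≤ (1 + g_n²β′(n−m))^{1/2} g_m
  ≤ (1 + g_n²β′)^{1/2}(n−m)^{1/2} g_m ≤ (1+β₀)(n−m)^{1/2} g_m, g_m ≤ (1+β₀) g_n, (2.6) where n > m, and β₀ > 0 can be
  chosen arbitrarily small, if g is sufficiently small."*; p. 256 [14], (2.8) first member *"ε_n ≤ (1+β₀)(n−m)^{1/2}
  ε_m"* and *"Similar inequalities hold for other constants, which will be introduced later."*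

NOTATION.  [IV] writes `p₁(g) = (log g⁻²)^{p₁}` WITHOUT the constant `A₁`, and in (1.94) `p₀(g_h)` likewise without
`A₀` (so that `(A₁/A₀)(p₁(g_h)/p₀(g_h)) ε_h = g_h A₁ p₁(g_h) = δ′_h`), while [III] (2.4) folds `A₀` into `p₀(·)`.  In
the tree `Setup.p0Profile A p g = A · (log g⁻²)^p` carries the constant and `Setup.epsK A p F j = g_j · p0Profile A p
(g_j)`; hence `ε_j = epsK A₀ p₀ F j` AND `δ′_j = epsK A₁ p₁ F j` — the SAME profile with `(A₀, p₀) ↦ (A₁, p₁)`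
(`deltaPrimeK`, `deltaPrimeK_eq_epsK` below, both `rfl`).  The A-free powers are `logPow p g := (log g⁻²)^p`.

WHAT THIS MODULE DOES (audit cell `pub-balaban`, unit `b2b-balaban-r2-g20` = reader group B+C gen 20, one-writer
lineage of `B10`–`B16.lean` and of `HOME/SMALLNESS.md`; journal row SMALLNESS-V2.25-ADV7G35-FOLD +
B15INEQ194FLOW-KERNEL; value = a KERNEL CERTIFICATE of a bookkeeping inference between two papers of the series, NOT
summit progress).  The cell's GAPS row C-adv7-69 (b) (adversarial reader adv7-g35, 2026-08-19) located in the first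
term of (1.94) a TACIT INPUT: the print keeps `p₁(g_h)` at the EARLIER scale `h`, i.e. uses `p₁(g_k) ≤ p₁(g_h) ⟺
g_k ≥ g_h` (k > h) — the monotone flow, whose source would be the unprinted sign of the β-functions (GAPS G-r2.1) —,
and offered the sign-free repair "(2.7) first member ⇒ (1+β₀)² in place of (1+β₀)".  This module shows that NEITHER
the sign NOR the extra factor is needed: the printed first term of (1.94), with its SINGLE factor `(1+β₀)`, is
EXACTLY the `δ′`-instance `δ′_k ≤ (1+β₀)(k−h)^{1/2} δ′_h` of the first member of (2.8) ([III] p. 256: *"Similar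
inequalities hold for other constants"*), and that instance follows SIGN-FREE from (0.20) [I], `0 < g_j ≤ γ`, the
PRINTED upper bound `β_{j+1}(g_j) ≤ β′` and the smallness clauses `B14FlowStep.SmallnessFor γ β′ β₀ L p₁`, by the
cell's D-sb14.1a dichotomy (`B14FlowStep.flowIneq28a_signfree`, unit strat-b14 gen 2, p176851: if `g_k ≤ g_h` the
profile `x ↦ x(log x⁻²)^{p₁}` is nondecreasing on `]0, γ]` once `log γ⁻² ≥ 2p₁` — `eps_profile_mono` —; if
`g_h < g_k` the log-power is `≤ 1` and (2.6abc) gives the coupling ratio).  Items: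

* §1 `deltaPrimeK` (δ′ of [IV] (1.27)), `deltaPrimeK_eq_epsK` (rfl), `logPow`, `smallnessFor_of_exponent_le`
  (`SmallnessFor` is antitone in the exponent: its two `p`-clauses `h27a`/`h27b` weaken as `p` decreases, so the
  structure at `p₀` serves every `p₁ ≤ p₀` — [IV] p. 183 *"p₁ < p₀"*).
* §2 `deltaPrime_flow_signfree`: `δ′_n ≤ (1+β₀)(n−m)^{1/2} δ′_m` for all `m < n ≤ K`, NO sign hypothesis
  (= `flowIneq28a_signfree` at `(A₁, p₁)`).
* §3 `deltaPrimeK_eq_ratio_mul_epsK`: the printed shape `δ′_h = (A₁/A₀)(p₁(g_h)/p₀(g_h)) ε_h` (for `A₀ ≠ 0`,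
  `0 < g_h < 1`); `ineq194_first_term_signfree`, `ineq194_second_term_signfree` and the assembled
  `ineq194_first_le_signfree`: the first "≤" of (1.94) with the printed `(1+β₀)` in the first term and with the
  printed `O(1)` of the second term read as `O(1)·(1+β₀)` (`(1+β₀) ≤ 2` by `SmallnessFor.β₀_le_one`; [IV] writes the
  same symbol `O(1)` on both sides).
* §4 NON-VACUITY: the hypotheses of `ineq194_first_le_signfree` are jointly satisfiable (`hypotheses_inhabited`: the
  flat flow `g ≡ e^{−10}`, `β ≡ 0 ≤ β′ = 1`, `γ = e^{−10}`, `β₀ = 1/2`, `L = 2`, `p₀ = 2`, `p₁ = 1`, from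
  `B14FlowStep.smallnessFor_example`).

CONSEQUENCE FOR THE CELL'S CENSUS (recorded in `HOME/SMALLNESS.md` v2.25 S-B15.9 and GAPS C-r2.50): the first
inequality of (1.94) consumes NO input beyond the explicit flow hypotheses of the typed §2 [III] description and the
standing γ-clauses; in particular it is NOT a consumer of the unprinted sign of the β-functions (G-r2.1 / node T09.F),
and the located tacit step of C-adv7-69 (b) is discharged at no constant cost.  The second inequality "< αε_h" (the
two restrictions on `N`) is `B15BasicStep.RestrN194` / `restrN194_exponent` (first term) and the cell's row C-adv4-4
(second term) — untouched here.
-/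

namespace Literature.MathematicalPhysics.QuantumFieldTheory.Balaban1983to89.B15.Ineq194Flow

open Literature.MathematicalPhysics.QuantumFieldTheory.Balaban1983to89
open Literature.MathematicalPhysics.QuantumFieldTheory.Balaban1983to89.B14FlowStep

noncomputable section

/-! ## §1. `δ′_j`, the A-free log-powers, exponent monotonicity of `SmallnessFor` -/

/-- **δ′_j** of [IV] (1.27), p. 183 l. 1, verbatim: *"δ′_j = g_j A₁ p₁(g_j), p₁(g_j) = (log g_j⁻²)^{p₁}, and p₁ < p₀"* —
along a flow `F`, with the constant `A₁` carried by `Setup.p0Profile`. [cite: Balaban1989LargeFieldI, (1.27) p.183] -/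
def deltaPrimeK (A₁ : ℝ) (p₁ : ℕ) (F : Flow) (j : ℕ) : ℝ := F.g j * p0Profile A₁ p₁ (F.g j)

/-- `δ′_j` IS the tree's `ε`-profile with `(A₀, p₀) ↦ (A₁, p₁)` — definitionally. [folklore] -/
theorem deltaPrimeK_eq_epsK (A₁ : ℝ) (p₁ : ℕ) (F : Flow) (j : ℕ) : deltaPrimeK A₁ p₁ F j = epsK A₁ p₁ F j := rfl

/-- The A-free power `p(g) := (log g⁻²)^p` of [IV] p. 183 (`p₁(g)`) and of (1.94)'s `p₀(g_h)`. [cite: Balaban1989LargeFieldI, (1.27) p.183] -/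
def logPow (p : ℕ) (g : ℝ) : ℝ := (Real.log (g ^ 2)⁻¹) ^ p

/-- `Setup.p0Profile A p g = A · (log g⁻²)^p` — the constant times the A-free power. [folklore] -/
theorem p0Profile_eq_mul_logPow (A : ℝ) (p : ℕ) (g : ℝ) : p0Profile A p g = A * logPow p g := rfl

/-- For `0 < g < 1` the A-free power is positive (so the printed quotient `p₁(g_h)/p₀(g_h)` is a genuine real
quotient, no junk value). [folklore] -/
theorem logPow_pos {g : ℝ} (hg : 0 < g) (hg1 : g < 1) (p : ℕ) : 0 < logPow p g := by
  unfold logPow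
  apply pow_pos
  apply Real.log_pos
  rw [one_lt_inv₀ (by positivity)]
  exact pow_lt_one₀ hg.le hg1 two_ne_zero

/-- `B14FlowStep.SmallnessFor γ β′ β₀ L p` is ANTITONE in the exponent `p`: only `h27a : 4p + 2 ≤ log γ⁻²` and
`h27b : p ≤ β₀ log γ⁻²` mention `p`, and both weaken as `p` decreases.  Used with [IV] p. 183 *"p₁ < p₀"*: the
structure at `p₀` serves `p₁`. [folklore] -/
theorem smallnessFor_of_exponent_le {γ β' β₀ : ℝ} {L p p₁ : ℕ} (h : p₁ ≤ p) (S : SmallnessFor γ β' β₀ L p) :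
    SmallnessFor γ β' β₀ L p₁ := by
  have hcast : (p₁ : ℝ) ≤ p := by exact_mod_cast h
  refine ⟨S.γ_pos, S.γ_lt_one, S.β'_nonneg, S.β₀_pos, S.β₀_le_one, S.h26c, S.h27c, ?_, ?_, S.hL, S.h29c⟩
  · linarith [S.h27a]
  · have hβ₀ := S.β₀_pos
    have hlog : 0 ≤ Real.log (γ ^ 2)⁻¹ := by linarith [S.h27a]
    calc (p₁ : ℝ) ≤ p := hcast
      _ ≤ β₀ * Real.log (γ ^ 2)⁻¹ := S.h27b

/-! ## §2. The `δ′`-instance of (2.8)'s first member — sign-free -/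

/-- **`δ′_n ≤ (1+β₀)(n−m)^{1/2} δ′_m` for all `m < n ≤ K`, SIGN-FREE** — [III] p. 256 *"Similar inequalities hold for
other constants, which will be introduced later"*, instance `δ′` of [IV] (1.27): from (0.20) [I], `0 < g_j ≤ γ`
(`j ≤ K`), the PRINTED upper bound `β_{j+1}(g_j) ≤ β′` and `SmallnessFor γ β′ β₀ L p₁`; NO sign / monotonicity of the
β-functions or of the couplings.  This is `B14FlowStep.flowIneq28a_signfree` (D-sb14.1a) at `(A₁, p₁)`. [cite: Balaban1988Convergent, (2.8) p.256] -/
theorem deltaPrime_flow_signfree (F : Flow) (K : ℕ) {γ β' β₀ : ℝ} {L p₁ : ℕ} (S : SmallnessFor γ β' β₀ L p₁)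
    {A₁ : ℝ} (hA₁ : 0 ≤ A₁) (hrg : F.SatisfiesRG K) (hI : F.InInterval γ K)
    (hub : ∀ j, j < K → F.β (j + 1) (F.g j) ≤ β') {m n : ℕ} (hmn : m < n) (hnK : n ≤ K) :
    deltaPrimeK A₁ p₁ F n ≤ (1 + β₀) * Real.sqrt ((n : ℝ) - m) * deltaPrimeK A₁ p₁ F m :=
  flowIneq28a_signfree F K S hA₁ hrg hI hub hmn hnK

/-! ## §3. (1.94), first inequality, as printed -/

/-- The PRINTED SHAPE of the first term's right side: `δ′_h = (A₁/A₀) · (p₁(g_h)/p₀(g_h)) · ε_h` ([IV] (1.94) with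
(1.27) and [III] (2.4); A-free `p₁`, `p₀`), valid for `A₀ ≠ 0` and `0 < g_h < 1`. [cite: Balaban1989LargeFieldI, (1.94) p.198] -/
theorem deltaPrimeK_eq_ratio_mul_epsK {A₀ A₁ : ℝ} (hA₀ : A₀ ≠ 0) {p₀ p₁ : ℕ} (F : Flow) {h : ℕ}
    (hg : 0 < F.g h) (hg1 : F.g h < 1) :
    deltaPrimeK A₁ p₁ F h = (A₁ / A₀) * (logPow p₁ (F.g h) / logPow p₀ (F.g h)) * epsK A₀ p₀ F h := by
  have hP : logPow p₀ (F.g h) ≠ 0 := (logPow_pos hg hg1 p₀).ne'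
  unfold deltaPrimeK epsK
  rw [p0Profile_eq_mul_logPow, p0Profile_eq_mul_logPow]
  field_simp

/-- **(1.94), FIRST TERM, as printed, sign-free**: `B₃ δ′_k ≤ B₃ (1+β₀) N^{1/2} (A₁/A₀)(p₁(g_h)/p₀(g_h)) ε_h`, `N = k − h`
(`h < k ≤ K`, `0 ≤ B₃`, `0 < A₀`, `0 ≤ A₁`; flow hypotheses as in §2 with `SmallnessFor` at `p₁`). [cite: Balaban1989LargeFieldI, (1.94) p.198] -/
theorem ineq194_first_term_signfree (F : Flow) (K : ℕ) {γ β' β₀ : ℝ} {L p₀ p₁ : ℕ} (S : SmallnessFor γ β' β₀ L p₁)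
    {A₀ A₁ B₃ : ℝ} (hA₀ : 0 < A₀) (hA₁ : 0 ≤ A₁) (hB₃ : 0 ≤ B₃) (hrg : F.SatisfiesRG K) (hI : F.InInterval γ K)
    (hub : ∀ j, j < K → F.β (j + 1) (F.g j) ≤ β') {h k : ℕ} (hhk : h < k) (hkK : k ≤ K) :
    B₃ * deltaPrimeK A₁ p₁ F k ≤
      B₃ * ((1 + β₀) * Real.sqrt ((k : ℝ) - h) *
        ((A₁ / A₀) * (logPow p₁ (F.g h) / logPow p₀ (F.g h)) * epsK A₀ p₀ F h)) := by
  have hgh : 0 < F.g h ∧ F.g h ≤ γ := hI h (le_trans hhk.le hkK)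
  rw [← deltaPrimeK_eq_ratio_mul_epsK hA₀.ne' F hgh.1 (lt_of_le_of_lt hgh.2 S.γ_lt_one)]
  exact mul_le_mul_of_nonneg_left (deltaPrime_flow_signfree F K S hA₁ hrg hI hub hhk hkK) hB₃

/-- **(1.94), SECOND TERM, sign-free**: `L^{−(k−h)} C ε_k ≤ L^{−N} N^{1/2} (C(1+β₀)) ε_h`, `N = k − h` — the first
member of (2.8) itself (`flowIneq28a_signfree` at `(A₀, p₀)`), the factor `(1+β₀)` going into the printed `O(1)`
(`C = O(1)B₃³B₅M⁶ ≥ 0`, `1 ≤ L`). [cite: Balaban1989LargeFieldI, (1.94) p.198] -/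
theorem ineq194_second_term_signfree (F : Flow) (K : ℕ) {γ β' β₀ : ℝ} {L p₀ : ℕ} (S : SmallnessFor γ β' β₀ L p₀)
    {A₀ C Lr : ℝ} (hA₀ : 0 ≤ A₀) (hC : 0 ≤ C) (hLr : 0 < Lr) (hrg : F.SatisfiesRG K) (hI : F.InInterval γ K)
    (hub : ∀ j, j < K → F.β (j + 1) (F.g j) ≤ β') {h k : ℕ} (hhk : h < k) (hkK : k ≤ K) :
    Lr ^ (-((k : ℝ) - h)) * C * epsK A₀ p₀ F k ≤
      Lr ^ (-((k : ℝ) - h)) * Real.sqrt ((k : ℝ) - h) * (C * (1 + β₀)) * epsK A₀ p₀ F h := by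
  have h28 := flowIneq28a_signfree F K S hA₀ hrg hI hub hhk hkK
  have hL : 0 ≤ Lr ^ (-((k : ℝ) - h)) := (Real.rpow_pos_of_pos hLr _).le
  have := mul_le_mul_of_nonneg_left h28 (mul_nonneg hL hC)
  calc Lr ^ (-((k : ℝ) - h)) * C * epsK A₀ p₀ F k
      ≤ Lr ^ (-((k : ℝ) - h)) * C * ((1 + β₀) * Real.sqrt ((k : ℝ) - h) * epsK A₀ p₀ F h) := this
    _ = Lr ^ (-((k : ℝ) - h)) * Real.sqrt ((k : ℝ) - h) * (C * (1 + β₀)) * epsK A₀ p₀ F h := by ring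

/-- **(1.94), FIRST INEQUALITY, AS PRINTED and SIGN-FREE**:
`B₃δ′_k + L^{−(k−h)} C ε_k ≤ B₃(1+β₀)N^{1/2}(A₁/A₀)(p₁(g_h)/p₀(g_h))ε_h + L^{−N}N^{1/2} (C(1+β₀)) ε_h`, `N = k − h`,
for every pair `h < k ≤ K`, from: the renormalization group equations (0.20) [I] (`SatisfiesRG`), the interval
hypothesis `0 < g_j ≤ γ` (`InInterval`), the PRINTED upper bound `β_{j+1}(g_j) ≤ β′`, the smallness clauses
`SmallnessFor γ β′ β₀ L p₀` of the typed §2 [III] description and `p₁ ≤ p₀` ([IV] p. 183) — and NOTHING on the sign of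
the β-functions.  Printed constants: the single `(1+β₀)` of the first term exactly; the second term's `O(1)` read as
`O(1)·(1+β₀) ≤ 2·O(1)`.  Answers the cell's GAPS C-adv7-69 (b). [cite: Balaban1989LargeFieldI, (1.94) p.198] -/
theorem ineq194_first_le_signfree (F : Flow) (K : ℕ) {γ β' β₀ : ℝ} {L p₀ p₁ : ℕ} (S : SmallnessFor γ β' β₀ L p₀)
    (hp : p₁ ≤ p₀) {A₀ A₁ B₃ C Lr : ℝ} (hA₀ : 0 < A₀) (hA₁ : 0 ≤ A₁) (hB₃ : 0 ≤ B₃) (hC : 0 ≤ C) (hLr : 0 < Lr)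
    (hrg : F.SatisfiesRG K) (hI : F.InInterval γ K) (hub : ∀ j, j < K → F.β (j + 1) (F.g j) ≤ β')
    {h k : ℕ} (hhk : h < k) (hkK : k ≤ K) :
    B₃ * deltaPrimeK A₁ p₁ F k + Lr ^ (-((k : ℝ) - h)) * C * epsK A₀ p₀ F k ≤
      B₃ * ((1 + β₀) * Real.sqrt ((k : ℝ) - h) *
          ((A₁ / A₀) * (logPow p₁ (F.g h) / logPow p₀ (F.g h)) * epsK A₀ p₀ F h)) +
        Lr ^ (-((k : ℝ) - h)) * Real.sqrt ((k : ℝ) - h) * (C * (1 + β₀)) * epsK A₀ p₀ F h :=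
  add_le_add
    (ineq194_first_term_signfree F K (smallnessFor_of_exponent_le hp S) hA₀ hA₁ hB₃ hrg hI hub hhk hkK)
    (ineq194_second_term_signfree F K S hA₀.le hC hLr hrg hI hub hhk hkK)

/-- The two factors `(1+β₀)` the literal route would produce (C-adv7-69 (b)'s "(1+β₀)² in place of (1+β₀)") are NOT
needed; for the record, under `SmallnessFor` one has `1 + β₀ ≤ 2`, so reading the second term's `O(1)` as
`O(1)(1+β₀)` changes the printed `O(1)` by at most a factor `2`. [folklore] -/
theorem one_add_beta0_le_two {γ β' β₀ : ℝ} {L p : ℕ} (S : SmallnessFor γ β' β₀ L p) : 1 + β₀ ≤ 2 := by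
  linarith [S.β₀_le_one]

/-! ## §4. Non-vacuity -/

/-- The flat flow `g ≡ e^{−10}`, `β ≡ 0`. [folklore] -/
def flatFlow : Flow := ⟨fun _ => Real.exp (-10), fun _ _ => 0⟩

/-- The flat flow satisfies the recursion (0.20) [I] (`β ≡ 0`). [folklore] -/
theorem flatFlow_satisfiesRG (K : ℕ) : flatFlow.SatisfiesRG K := by
  intro k _
  simp [flatFlow]

/-- The flat flow lies in `]0, e^{−10}]`. [folklore] -/
theorem flatFlow_inInterval (K : ℕ) : flatFlow.InInterval (Real.exp (-10)) K := by
  intro k _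
  exact ⟨Real.exp_pos _, le_rfl⟩

/-- The flat flow's β-functions (`≡ 0`) obey the printed upper bound with `β′ = 1`. [folklore] -/
theorem flatFlow_beta_le (K : ℕ) : ∀ j, j < K → flatFlow.β (j + 1) (flatFlow.g j) ≤ (1 : ℝ) := by
  intro j _
  simp [flatFlow]

/-- **NON-VACUITY.** Every hypothesis of `ineq194_first_le_signfree` holds at once for the flat flow with
`γ = e^{−10}`, `β′ = 1`, `β₀ = 1/2`, `L = 2`, `p₀ = 2`, `p₁ = 1`, `A₀ = A₁ = B₃ = C = 1`, `L (real) = 2`, `K = 5`,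
`(h, k) = (1, 3)` (from `B14FlowStep.smallnessFor_example`), and the conclusion is then an instance of the theorem. [folklore] -/
theorem hypotheses_inhabited :
    ∃ (F : Flow) (K : ℕ) (γ β' β₀ : ℝ) (L p₀ p₁ : ℕ) (A₀ A₁ B₃ C Lr : ℝ) (h k : ℕ),
      SmallnessFor γ β' β₀ L p₀ ∧ p₁ ≤ p₀ ∧ 0 < A₀ ∧ 0 ≤ A₁ ∧ 0 ≤ B₃ ∧ 0 ≤ C ∧ 0 < Lr ∧
      F.SatisfiesRG K ∧ F.InInterval γ K ∧ (∀ j, j < K → F.β (j + 1) (F.g j) ≤ β') ∧ h < k ∧ k ≤ K ∧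
      B₃ * deltaPrimeK A₁ p₁ F k + Lr ^ (-((k : ℝ) - h)) * C * epsK A₀ p₀ F k ≤
        B₃ * ((1 + β₀) * Real.sqrt ((k : ℝ) - h) *
            ((A₁ / A₀) * (logPow p₁ (F.g h) / logPow p₀ (F.g h)) * epsK A₀ p₀ F h)) +
          Lr ^ (-((k : ℝ) - h)) * Real.sqrt ((k : ℝ) - h) * (C * (1 + β₀)) * epsK A₀ p₀ F h := by
  refine ⟨flatFlow, 5, Real.exp (-10), 1, 1 / 2, 2, 2, 1, 1, 1, 1, 1, 2, 1, 3, smallnessFor_example, by norm_num,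
    one_pos, zero_le_one, zero_le_one, zero_le_one, two_pos, flatFlow_satisfiesRG 5, flatFlow_inInterval 5,
    flatFlow_beta_le 5, by norm_num, by norm_num, ?_⟩
  exact ineq194_first_le_signfree flatFlow 5 smallnessFor_example (by norm_num) one_pos zero_le_one zero_le_one
    zero_le_one two_pos (flatFlow_satisfiesRG 5) (flatFlow_inInterval 5) (flatFlow_beta_le 5) (by norm_num)
    (by norm_num)

end

end Literature.MathematicalPhysics.QuantumFieldTheory.Balaban1983to89.B15.Ineq194Flow
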